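import Summits.CriticalPhenomena.CardyFormulaZ2.Theorems.CardySusyWardParafermionPrecompactFourClassTransferCore
import Summits.CriticalPhenomena.CardyFormulaZ2.Theorems.ParafermionPrecompact.Negative.ParafermionPrecompactFalseOfBulkNondegenerate

/-!
# The four-class vertex transfer, per domain: class-component bounds ⇒ the repaired crux `C′(D, Λ)`

Line `four-class-vertex-transfer` of the crux `ParafermionPrecompact` (route `CardySusyWard`, item
stmt-CriticalPhenomena-11293), lead `prover-line-stmt-CriticalPhenomena-11293-c1-0`. BY-NAME form of the
route-free core `repairedClauses_of_classBounds` (`…FourClassTransferCore`): the crux AS TYPED is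
`¬ ParafermionBulkNondegenerate` (`Negative.parafermionPrecompact_iff_not_bulkNondegenerate`), so the
closable statement is the standing disprover's repair `C′(D, Λ) = Negative.ParafermionPrecompactRepairedAt D Λ`
(the rev-5 text with the two `edgeSet` guards), and

* `parafermionPrecompactRepairedAt_of_classBounds` (registered sub-goal): FOR ONE Dobrushin domain `D`
  and ONE `Λ`, a class-component bound `‖g_q(w)‖ ≤ C δ^{1/3}` and SAME-CLASS equicontinuity
  `‖g_q(w) - g_q(w')‖ ≤ ε δ^{1/3}` of the spin-`1/3` dart field on compacts imply `C′(D, Λ)` — by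
  unfolding `ParafermionPrecompactRepairedAt` / `IsFamily` / `F` into the clauses of the core theorem.

(a) ∧ (b) for every `(D, Λ)` with `Ω = D`, mesh `δ`, eventually admissible is `CardyComplexCone.EdgePrecompact`
(stmt-11387) restricted to the class corners — file `…FourClassTransferOfEdgePrecompact`. Honest label
(card + triage): the dart statement is logically STRONGER than `C′`; the transfer is organisational.
References: S. Smirnov, Ann. of Math. 172 (2010), §2.2 [Smirnov2010]; H. Duminil-Copin, S. Smirnov,
Clay Math. Proc. 15 (2012), §8.3 [DuminilCopinSmirnov2012Lattice].
-/

noncomputable section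

namespace Summit.CriticalPhenomena.CardyFormulaZ2.Cruxes.ParafermionPrecompact.FourClassVertexTransfer

open scoped BigOperators Topology
open Filter Set MeasureTheory
open _root_.Literature.Probability.LatticeModels
open _root_.Literature.Probability.RandomPlanarGeometry (DobrushinDomain)
open _root_.Literature.Probability.Percolation (BondConfig bondPercolation half)
open Summit.CriticalPhenomena.CardyFormulaZ2.Theorems.ParafermionPrecompact.Negative
  (F IsFamily ClauseBoundEdges ClauseEquicontEdges ParafermionPrecompactRepairedAt)
open KenyonStreamSecondRelation (classComp dartField)

/-- **The four-class vertex transfer (per `(D, Λ)`), by name** — registered sub-goal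
`parafermionPrecompactRepairedAt_of_classBounds`: if the four class components
`g_q = classComp (dartField (Λ δ)) q` of the spin-`1/3` dart field of `Λ δ` satisfy, on every compact
`K ⊆ Ω`, eventually in `δ`, (a) `‖g_q(w)‖ ≤ C δ^{1/3}` for `δw ∈ K` and (b) SAME-CLASS equicontinuity
`‖g_q(w) - g_q(w')‖ ≤ ε δ^{1/3}` for `δw, δw' ∈ K` at distance `< η(ε)`, then the REPAIRED crux of
stmt-CriticalPhenomena-11293 holds for `(D, Λ)`: `Negative.ParafermionPrecompactRepairedAt D Λ` (clause (i)
with constant `4C`, clause (ii) with `η = η'(ε/4)/2`; the family's mesh and marks fields feed the dart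
dictionary). [folklore] -/
theorem parafermionPrecompactRepairedAt_of_classBounds :
    ∀ (D : DobrushinDomain) (Λ : ℝ → DiscreteDobrushin), (∀ K : Set ℂ, IsCompact K → K ⊆ D.carrier → ∃ C : ℝ, ∀ᶠ δ in 𝓝[>] (0:ℝ), ∀ (q : Fin 4) (w : Site 2), meshPoint δ w ∈ K → ‖classComp (dartField (Λ δ)) q w‖ ≤ C * δ ^ ((1:ℝ) / 3)) → (∀ K : Set ℂ, IsCompact K → K ⊆ D.carrier → ∀ ε > (0:ℝ), ∃ η > (0:ℝ), ∀ᶠ δ in 𝓝[>] (0:ℝ), ∀ (q : Fin 4) (w w' : Site 2), meshPoint δ w ∈ K → meshPoint δ w' ∈ K → dist (meshPoint δ w) (meshPoint δ w') < η → ‖classComp (dartField (Λ δ)) q w - classComp (dartField (Λ δ)) q w'‖ ≤ ε * δ ^ ((1:ℝ) / 3)) → ParafermionPrecompactRepairedAt D Λ := by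
  intro D Λ hbound hequi hfam K hK hKD
  exact repairedClauses_of_classBounds D Λ hfam.2.1 hfam.2.2.2.2.1 hbound hequi K hK hKD

end Summit.CriticalPhenomena.CardyFormulaZ2.Cruxes.ParafermionPrecompact.FourClassVertexTransfer

end
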